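import Summits.CriticalPhenomena.CardyFormulaZ2.Theorems.CardyBoundaryCoulombGasRectilinearSufficesLowerSandwich

/-!
# The upper sandwich: the quad crosses less than perturbations of the short wide model rectangle

Support file for `RectilinearSuffices` (route CardyBoundaryCoulombGas of `CardyFormulaZ2`,
item stmt-CriticalPhenomena-5663). Companion of the lower sandwich: for a square model `Φ` and
`t, τ > 0` (`τ < 1/2`), let `D⁺ = Φ((-1-t, 1+t) × (-1+τ, 1-τ))` be the image of the *wider and
shorter* rectangle (it sticks out of the quad across the arcs `1`, `3` and is cut inside along the
arcs `0`, `2`). Every conformal rectangle `P` whose boundary loop is uniformly `ε₁`-close to that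
of `D⁺`, with the same marks, is in mixed position ABOVE the re-modelled quad
`unitSquareQuad.map Φ`: for all small meshes the G02 crossing event of the quad is contained in
that of `P` (`exists_upper_sandwich`); `ε₁ > 0` depends only on `Φ, t, τ`.
-/

noncomputable section

namespace Summit.CriticalPhenomena.CardyFormulaZ2.Theorems

open Set Metric Filter Topology Complex
open Literature.Probability.RandomPlanarGeometry Literature.Probability.Percolation
open Literature.Probability.LatticeModels

/-- The frontier of a conformal rectangle off its arc `0` lies in the union of the arcs `1, 2, 3`,
and off its arc `2` in the union of the arcs `0, 1, 3` (the arcs cover the frontier). [folklore] -/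
theorem frontier_diff_arc_subset (P : ConformalRectangle) :
    frontier P.carrier \ P.arc 0 ⊆ P.arc 1 ∪ P.arc 2 ∪ P.arc 3 ∧
      frontier P.carrier \ P.arc 2 ⊆ P.arc 0 ∪ P.arc 1 ∪ P.arc 3 := by
  have hU : ⋃ i, P.arc i = frontier P.carrier := MarkedDomain.iUnion_arc_holds P
  constructor
  · rintro z ⟨hz, hz0⟩
    rw [← hU, mem_iUnion] at hz
    obtain ⟨i, hi⟩ := hz
    fin_cases i
    · exact absurd hi hz0
    · exact Or.inl (Or.inl hi)
    · exact Or.inl (Or.inr hi)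
    · exact Or.inr hi
  · rintro z ⟨hz, hz2⟩
    rw [← hU, mem_iUnion] at hz
    obtain ⟨i, hi⟩ := hz
    fin_cases i
    · exact Or.inl (Or.inl hi)
    · exact Or.inl (Or.inr hi)
    · exact absurd hi hz2
    · exact Or.inr hi

/-- The two complementary pieces of the frontier of a conformal rectangle are nonempty (the arcs
`0` and `2` are disjoint). [folklore] -/
theorem frontier_diff_arc_nonempty (P : ConformalRectangle) :
    (frontier P.carrier \ P.arc 0).Nonempty ∧ (frontier P.carrier \ P.arc 2).Nonempty := by
  have hd := P.disjoint_arc_zero_arc_two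
  exact ⟨⟨P.pt 2, P.pt_mem_frontier 2, fun h => Set.disjoint_left.1 hd h (P.pt_mem_arc_self 2)⟩,
    ⟨P.pt 0, P.pt_mem_frontier 0, fun h => Set.disjoint_right.1 hd h (P.pt_mem_arc_self 0)⟩⟩

/-- **The upper sandwich.** See the module docstring. [folklore] -/
theorem exists_upper_sandwich (Φ : ℂ ≃ₜ ℂ) {t τ : ℝ} (ht : 0 < t) (hτ : 0 < τ) (hτ1 : τ < 1 / 2) :
    ∃ ε₁ > 0, ∀ P : ConformalRectangle, (∀ i, P.mark i = quarterMarks i) →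
      (∀ s, dist (P.boundary s)
        ((perturbQuad Φ (-1 - t) (1 + t) (-1 + τ) (1 - τ) (by linarith) (by linarith)).boundary s)
          ≤ ε₁) →
      ∃ δ₀ > 0, ∀ δ, 0 < δ → δ < δ₀ →
        discreteCrossing (unitSquareQuad.map Φ).carrier δ ((unitSquareQuad.map Φ).arc 0)
            ((unitSquareQuad.map Φ).arc 2) ⊆
          discreteCrossing P.carrier δ (P.arc 0) (P.arc 2) := by
  have hx : (-1 - t : ℝ) < 1 + t := by linarith
  have hy : (-1 + τ : ℝ) < 1 - τ := by linarith
  set D := perturbQuad Φ (-1 - t) (1 + t) (-1 + τ) (1 - τ) hx hy with hD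
  set Q := unitSquareQuad.map Φ with hQ
  -- the model tolerance and the uniform continuity of `Φ⁻¹` near the closed rectangle
  set ε₂ : ℝ := min τ t / 4 with hε₂
  have hε₂pos : 0 < ε₂ := by positivity
  have hε₂τ : 2 * ε₂ < τ := by
    have := min_le_left τ t; rw [hε₂]; linarith
  have hε₂t : ε₂ < t := by
    have := min_le_right τ t; rw [hε₂]; linarith
  set K : Set ℂ := Icc (-1 - t) (1 + t) ×ℂ Icc (-1 + τ) (1 - τ) with hK
  have hKc : IsCompact K := isCompact_Icc.reProdIm isCompact_Icc
  obtain ⟨ε₁', hε₁', -, hΦ⟩ := exists_forall_dist_symm_le Φ hKc hε₂pos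
  -- the middle band of the closed square is a compact subset of `D⁺`, off `∂D⁺`
  set Kmid : Set ℂ := Φ '' (Icc (-1) 1 ×ℂ Icc (-1 / 2) (1 / 2)) with hKmid
  have hKmidc : IsCompact Kmid := (isCompact_Icc.reProdIm isCompact_Icc).image Φ.continuous
  have hKmidD : Kmid ⊆ D.carrier := by
    rintro _ ⟨w, hw, rfl⟩
    rw [hD, perturbQuad, MarkedDomain.carrier_map, Φ.injective.mem_set_image, mem_rectQuad_carrier]
    obtain ⟨⟨h1, h2⟩, h3, h4⟩ := mem_reProdIm.1 hw
    exact ⟨⟨by linarith, by linarith⟩, by linarith, by linarith⟩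
  have hfrne : (frontier D.carrier).Nonempty := ⟨_, D.boundary_mem_frontier 0⟩
  have hfrc : IsCompact (frontier D.carrier) := D.isCompact_frontier
  obtain ⟨d₀, hd₀, hfar⟩ := exists_pos_forall_lt_dist hKmidc isClosed_frontier
    (Set.disjoint_left.2 fun z hz hz' => Set.disjoint_left.1 D.disjoint_carrier_frontier (hKmidD hz) hz')
  refine ⟨min ε₁' (d₀ / 2), by positivity, fun P hmark hclose => ?_⟩
  have hclose' : ∀ s, dist (P.boundary s) (D.boundary s) ≤ ε₁' :=
    fun s => (hclose s).trans (min_le_left _ _)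
  have hmarkD : ∀ i, P.mark i = D.mark i := fun i => by rw [hmark, hD, perturbQuad_mark]
  -- reading a point of `closure P` in the model: its height is at most that of `K`, up to `ε₂`
  have hmodel : ∀ z ∈ closure P.carrier, (Φ.symm z).im ∈ Icc (-1 + τ - ε₂) (1 - τ + ε₂) := by
    intro z hz
    rcases mem_closure_or_infDist_le D.toJordanDomain P.toJordanDomain hclose' hz with h | h
    · rw [hD, mem_closure_perturbQuad_carrier] at h
      obtain ⟨-, h3, h4⟩ := h
      exact ⟨by linarith, by linarith⟩
    · obtain ⟨q, hq, hqd⟩ := hfrc.exists_infDist_eq_dist hfrne z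
      obtain ⟨q', hq', rfl⟩ := frontier_perturbQuad_subset Φ _ _ hq
      have hd : dist (Φ.symm z) q' ≤ ε₂ := hΦ q' hq' z (hqd ▸ h)
      have him := abs_le.1 (abs_im_sub_le_of_dist_le hd)
      obtain ⟨-, h3, h4⟩ := mem_reProdIm.1 hq'
      exact ⟨by linarith, by linarith⟩
  -- reading the arcs of `P` in the model
  have harc : ∀ (i : Fin 4), ∀ z ∈ P.arc i, ∃ q' ∈ (rectQuad (-1 - t) (1 + t) (-1 + τ) (1 - τ) hx hy).arc i,
      dist (Φ.symm z) q' ≤ ε₂ := by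
    intro i z hz
    obtain ⟨s, rfl, hs⟩ := exists_param_of_mem_arc hmarkD hz
    rw [hD, perturbQuad, MarkedDomain.arc_map, mem_image_homeomorph_iff] at hs
    refine ⟨_, hs, hΦ _ ?_ _ (by rw [Homeomorph.apply_symm_apply]; exact hclose' s)⟩
    have := frontier_subset_closure ((rectQuad (-1 - t) (1 + t) (-1 + τ) (1 - τ) hx hy).arc_subset_frontier i hs)
    rwa [closure_rectQuad_carrier] at this
  have harc0 : ∀ z ∈ P.arc 0, (Φ.symm z).im < 1 / 2 := by
    intro z hz
    obtain ⟨q', hq', hd⟩ := harc 0 z hz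
    rw [mem_rectQuad_arc_zero] at hq'
    have him := abs_le.1 (abs_im_sub_le_of_dist_le hd)
    rw [hq'.1] at him; linarith
  have harc2 : ∀ z ∈ P.arc 2, -(1 / 2) < (Φ.symm z).im := by
    intro z hz
    obtain ⟨q', hq', hd⟩ := harc 2 z hz
    rw [mem_rectQuad_arc_two] at hq'
    have him := abs_le.1 (abs_im_sub_le_of_dist_le hd)
    rw [hq'.1] at him; linarith
  have harc1 : ∀ z ∈ P.arc 1, 1 < (Φ.symm z).re := by
    intro z hz
    obtain ⟨q', hq', hd⟩ := harc 1 z hz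
    rw [mem_rectQuad_arc_one] at hq'
    have hre := abs_le.1 (abs_re_sub_le_of_dist_le hd)
    rw [hq'.1] at hre; linarith
  have harc3 : ∀ z ∈ P.arc 3, (Φ.symm z).re < -1 := by
    intro z hz
    obtain ⟨q', hq', hd⟩ := harc 3 z hz
    rw [mem_rectQuad_arc_three] at hq'
    have hre := abs_le.1 (abs_re_sub_le_of_dist_le hd)
    rw [hq'.1] at hre; linarith
  -- the pieces of the closed quad sticking out of `P`
  set H0 : Set ℂ := {w : ℂ | w.im ≤ -(1 / 2)} with hH0
  set H2 : Set ℂ := {w : ℂ | 1 / 2 ≤ w.im} with hH2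
  have hH0c : IsClosed (Φ '' H0) := Φ.isClosedMap _ (isClosed_le continuous_im continuous_const)
  have hH2c : IsClosed (Φ '' H2) := Φ.isClosedMap _ (isClosed_le continuous_const continuous_im)
  set F0 : Set ℂ := (closure Q.carrier ∩ Φ '' H0) ∩ P.carrierᶜ with hF0
  set F2 : Set ℂ := (closure Q.carrier ∩ Φ '' H2) ∩ P.carrierᶜ with hF2
  have hQc : IsCompact (closure Q.carrier) := Q.isBounded.isCompact_closure
  have hF0c : IsCompact F0 := (hQc.inter_right hH0c).inter_right P.isOpen.isClosed_compl
  have hF2c : IsCompact F2 := (hQc.inter_right hH2c).inter_right P.isOpen.isClosed_compl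
  have hclQ : ∀ z ∈ closure Q.carrier, (Φ.symm z).re ∈ Icc (-1 : ℝ) 1 ∧ (Φ.symm z).im ∈ Icc (-1 : ℝ) 1 := by
    intro z hz
    rw [hQ, closure_map_unitSquareQuad, mem_image_homeomorph_iff, mem_reProdIm] at hz
    exact hz
  obtain ⟨hsub0, hsub2⟩ := frontier_diff_arc_subset P
  obtain ⟨hne0, hne2⟩ := frontier_diff_arc_nonempty P
  refine exists_forall_discreteCrossing_subset_of_mixed Q P (F0 := F0) (F2 := F2)
    (C0 := P.arc 1 ∪ P.arc 2 ∪ P.arc 3) (C2 := P.arc 0 ∪ P.arc 1 ∪ P.arc 3) hF0c hF2c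
    (((P.isClosed_arc 1).union (P.isClosed_arc 2)).union (P.isClosed_arc 3))
    (((P.isClosed_arc 0).union (P.isClosed_arc 1)).union (P.isClosed_arc 3))
    ?_ ?_ ?_ ?_ hsub0 hsub2 ?_ ?_ hne0 hne2 ?_ ?_ ?_ ?_
  · -- closure Q ⊆ P ∪ F0 ∪ F2 : the middle band lies in `P` by the interior dog-on-leash
    intro z hz
    by_cases hzP : z ∈ P.carrier
    · exact Or.inl (Or.inl hzP)
    obtain ⟨hre, him⟩ := hclQ z hz
    by_cases h0 : (Φ.symm z).im ≤ -(1 / 2)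
    · exact Or.inl (Or.inr ⟨⟨hz, (mem_image_homeomorph_iff Φ).2 h0⟩, hzP⟩)
    by_cases h2 : 1 / 2 ≤ (Φ.symm z).im
    · exact Or.inr ⟨⟨hz, (mem_image_homeomorph_iff Φ).2 h2⟩, hzP⟩
    push Not at h0 h2
    exfalso
    have hzK : z ∈ Kmid := by
      rw [hKmid, mem_image_homeomorph_iff, mem_reProdIm]
      exact ⟨hre, by linarith, h2.le⟩
    have hzD : z ∈ D.carrier := hKmidD hzK
    obtain ⟨q, hq, hqd⟩ := hfrc.exists_infDist_eq_dist hfrne z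
    have hlt : min ε₁' (d₀ / 2) < infDist z (frontier D.carrier) := by
      rw [hqd]
      have := hfar z hzK q hq
      exact lt_of_le_of_lt (min_le_right _ _) (by linarith)
    exact hzP (mem_carrier_of_lt_infDist D.toJordanDomain P.toJordanDomain hclose hzD hlt)
  · exact Set.disjoint_left.2 fun z hz hz' => hz.2 hz'
  · exact Set.disjoint_left.2 fun z hz hz' => hz.2 hz'
  · refine Set.disjoint_left.2 fun z hz hz' => ?_
    have h0 : (Φ.symm z).im ≤ -(1 / 2) := (mem_image_homeomorph_iff Φ).1 hz.1.2
    have h2 : 1 / 2 ≤ (Φ.symm z).im := (mem_image_homeomorph_iff Φ).1 hz'.1.2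
    linarith
  · -- F0 off the arcs 1, 2, 3 of P
    refine Set.disjoint_left.2 fun z hz hz' => ?_
    obtain ⟨hre, -⟩ := hclQ z hz.1.1
    have h0 : (Φ.symm z).im ≤ -(1 / 2) := (mem_image_homeomorph_iff Φ).1 hz.1.2
    rcases hz' with (h | h) | h
    · linarith [harc1 z h, hre.2]
    · linarith [harc2 z h]
    · linarith [harc3 z h, hre.1]
  · refine Set.disjoint_left.2 fun z hz hz' => ?_
    obtain ⟨hre, -⟩ := hclQ z hz.1.1
    have h2 : 1 / 2 ≤ (Φ.symm z).im := (mem_image_homeomorph_iff Φ).1 hz.1.2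
    rcases hz' with (h | h) | h
    · linarith [harc0 z h]
    · linarith [harc1 z h, hre.2]
    · linarith [harc3 z h, hre.1]
  · -- arc 0 of Q (bottom side) off closure P
    rw [hQ, MarkedDomain.arc_map, Set.disjoint_left]
    rintro _ ⟨p, hp, rfl⟩ hz
    rw [SquareModel.mem_arc_zero] at hp
    have := hmodel _ hz
    rw [Homeomorph.symm_apply_apply, hp.1] at this
    linarith [this.1]
  · rw [hQ, MarkedDomain.arc_map, Set.disjoint_left]
    rintro _ ⟨p, hp, rfl⟩ hz
    rw [SquareModel.mem_arc_two] at hp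
    have := hmodel _ hz
    rw [Homeomorph.symm_apply_apply, hp.1] at this
    linarith [this.2]
  · rw [hQ, MarkedDomain.arc_map, Set.disjoint_left]
    rintro _ ⟨p, hp, rfl⟩ hz
    rw [SquareModel.mem_arc_zero] at hp
    have h2 : 1 / 2 ≤ (Φ.symm (Φ p)).im := (mem_image_homeomorph_iff Φ).1 hz.1.2
    rw [Homeomorph.symm_apply_apply, hp.1] at h2
    linarith
  · rw [hQ, MarkedDomain.arc_map, Set.disjoint_left]
    rintro _ ⟨p, hp, rfl⟩ hz
    rw [SquareModel.mem_arc_two] at hp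
    have h0 : (Φ.symm (Φ p)).im ≤ -(1 / 2) := (mem_image_homeomorph_iff Φ).1 hz.1.2
    rw [Homeomorph.symm_apply_apply, hp.1] at h0
    linarith

end Summit.CriticalPhenomena.CardyFormulaZ2.Theorems
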